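import Mathlib

/-!
# Route OverlapGapAlgebra, crux `SearchHardWindow` (stmt-PneNP-2460): the systematic-scan
# resampling walk — one-step decomposition and the fibrewise Jensen (part 1 of the scan
# correlation inequality)

Abstract setting (as in the engine of crux `SolvableImpliesStableSection`): symbols `S`, coordinates
`J`, schedule `σ : Fin T → J`, the coordinate-resampling walk `pos v U t` on `J → S` (start `v`, step
`t` overwrites coordinate `σ t` with the fresh symbol `U t`; specified by `hpos0`/`hposS` only), a set
of GOOD points (`InG`) and a symmetric reflexive STABILITY relation `St`. A symbol sequence `U` is
*good-and-stable from `v`* if all `T+1` positions are good and all `T` steps are stable.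

This file: the lazy continuation (`scc_card_pos`), the one-step decomposition of the good-and-stable
event along `U ↦ (U 0, tail U)` (`scc_decomp`, `scc_card_decomp`), and the analytic heart of the
potential argument in one direction `j` — the pointwise Jensen at a good point with the
doubly-stochastic weights `1/d` (stable good fibre-neighbours) and `(u+1)/d` (the point itself)
(`scc_pointwise`), and the exact re-summation of the cross terms through the involution
`(v, s) ↦ (v[j↦s], v j)` (`scc_exchange`), possible because the number `d_j` of good points on a
fibre is constant on the fibre. Continued in `…ScanStep.lean` and `…ScanCorrelation.lean`.
No definitions.
-/

set_option linter.dupNamespace false -- `Summit.PneNP.PneNP.…`: summit = sub-problem (D-0017)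

namespace Summit.PneNP.PneNP.Theorems

open Finset
open scoped Classical

section ScanCorrelation

variable {S J : Type*} [DecidableEq J]

/-! ### The walk: lazy continuation, agreement, one-step decomposition, fibrewise count -/

/-- From a good start the all-lazy symbol sequence keeps the walk at the start, so the number of
good-and-stable symbol sequences is positive. -/
theorem scc_card_pos [Fintype S] [DecidableEq S] (T : ℕ) (σ : Fin T → J)
    (InG : (J → S) → Prop) (St : (J → S) → (J → S) → Prop) (hrefl : ∀ v, St v v)
    (pos : (J → S) → (Fin T → S) → ℕ → (J → S))
    (hpos0 : ∀ v U, pos v U 0 = v)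
    (hposS : ∀ v U (t : Fin T), pos v U ((t : ℕ) + 1) = Function.update (pos v U t) (σ t) (U t))
    (v : J → S) (hv : InG v) : 0 < ((univ : Finset (Fin T → S)).filter fun U =>
      (∀ t : Fin (T + 1), InG (pos v U t)) ∧
        ∀ t : Fin T, St (pos v U t) (pos v U ((t : ℕ) + 1))).card := by
  have hlazy : ∀ t : ℕ, t ≤ T → pos v (fun t => v (σ t)) t = v := by
    intro t
    induction t with
    | zero => intro _; exact hpos0 _ _
    | succ t ih =>
      intro ht
      have h := hposS v (fun t => v (σ t)) ⟨t, ht⟩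
      simp only at h
      rw [h, ih (Nat.le_of_succ_le ht), Function.update_eq_self]
  refine Finset.card_pos.2 ⟨fun t => v (σ t), ?_⟩
  simp only [mem_filter, mem_univ, true_and]
  refine ⟨fun t => ?_, fun t => ?_⟩
  · rw [hlazy t (Nat.lt_succ_iff.mp t.isLt)]; exact hv
  · rw [hlazy t t.isLt.le, hlazy ((t : ℕ) + 1) t.isLt]; exact hrefl v

omit [DecidableEq J] in
/-- From a bad start no symbol sequence is good (position `0` is the start). -/
theorem scc_card_zero [Fintype S] (T : ℕ) (InG : (J → S) → Prop)
    (St : (J → S) → (J → S) → Prop) (pos : (J → S) → (Fin T → S) → ℕ → (J → S))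
    (hpos0 : ∀ v U, pos v U 0 = v) (v : J → S) (hv : ¬ InG v) :
    ((univ : Finset (Fin T → S)).filter fun U =>
      (∀ t : Fin (T + 1), InG (pos v U t)) ∧
        ∀ t : Fin T, St (pos v U t) (pos v U ((t : ℕ) + 1))).card = 0 := by
  refine Finset.card_eq_zero.2 (Finset.filter_eq_empty_iff.2 fun U _ h => hv ?_)
  have h0 := h.1 0
  rwa [Fin.val_zero, hpos0] at h0

/-- Two walks driven by the same symbols that agree at time `1` agree at all times `1, …, T`. -/
theorem scc_agree (T : ℕ) (σ : Fin T → J) (pos : (J → S) → (Fin T → S) → ℕ → (J → S))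
    (hposS : ∀ v U (t : Fin T), pos v U ((t : ℕ) + 1) = Function.update (pos v U t) (σ t) (U t))
    (v w : J → S) (U : Fin T → S) (h1 : pos v U 1 = pos w U 1) :
    ∀ t : ℕ, t + 1 ≤ T → pos v U (t + 1) = pos w U (t + 1) := by
  intro t
  induction t with
  | zero => intro _; exact h1
  | succ t ih =>
    intro ht
    have hv := hposS v U ⟨t + 1, ht⟩
    have hw := hposS w U ⟨t + 1, ht⟩
    simp only at hv hw
    rw [hv, hw, ih (Nat.le_of_succ_le ht)]

/-- One step of the walk: `Fin.cons s U'` is good-and-stable from `v` iff `v` is good, the first edge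
`v → v[σ 0 ↦ s]` is stable, and `U'` is good-and-stable for the REMAINING walk read off the same
position function from the new start `v[σ 0 ↦ s]`. -/
theorem scc_decomp (T : ℕ) (σ : Fin (T + 1) → J) (InG : (J → S) → Prop)
    (St : (J → S) → (J → S) → Prop)
    (pos : (J → S) → (Fin (T + 1) → S) → ℕ → (J → S)) (hpos0 : ∀ v U, pos v U 0 = v)
    (hposS : ∀ v U (t : Fin (T + 1)), pos v U ((t : ℕ) + 1) = Function.update (pos v U t) (σ t) (U t))
    (v : J → S) (s : S) (U' : Fin T → S) :
    ((∀ t : Fin (T + 1 + 1), InG (pos v (Fin.cons s U') t)) ∧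
        ∀ t : Fin (T + 1), St (pos v (Fin.cons s U') t) (pos v (Fin.cons s U') ((t : ℕ) + 1))) ↔
      ((InG v ∧ St v (Function.update v (σ 0) s)) ∧
        ((∀ t : Fin (T + 1), InG (pos (Function.update v (σ 0) s) (Fin.cons s U') ((t : ℕ) + 1))) ∧
          ∀ t : Fin T, St (pos (Function.update v (σ 0) s) (Fin.cons s U') ((t : ℕ) + 1))
            (pos (Function.update v (σ 0) s) (Fin.cons s U') ((t : ℕ) + 1 + 1)))) := by
  have hstart : pos v (Fin.cons s U') 1 = Function.update v (σ 0) s := by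
    simpa only [Fin.val_zero, zero_add, hpos0, Fin.cons_zero] using hposS v (Fin.cons s U') 0
  have h1 : pos v (Fin.cons s U') 1 = pos (Function.update v (σ 0) s) (Fin.cons s U') 1 := by
    have hw := hposS (Function.update v (σ 0) s) (Fin.cons s U') 0
    simp only [Fin.val_zero, zero_add, hpos0, Fin.cons_zero, Function.update_idem] at hw
    rw [hstart, hw]
  have hagree := scc_agree (T + 1) σ pos hposS v (Function.update v (σ 0) s) (Fin.cons s U') h1
  rw [Fin.forall_fin_succ (P := fun t => InG (pos v (Fin.cons s U') t)),
    Fin.forall_fin_succ (P := fun t : Fin (T + 1) =>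
      St (pos v (Fin.cons s U') t) (pos v (Fin.cons s U') ((t : ℕ) + 1)))]
  simp only [Fin.val_zero, Fin.val_succ, hpos0, zero_add]
  rw [hstart, and_and_and_comm]
  refine and_congr Iff.rfl (and_congr (forall_congr' fun t => ?_) (forall_congr' fun t => ?_))
  · rw [hagree t (by have := t.isLt; omega)]
  · rw [hagree t (by have := t.isLt; omega), hagree (t + 1) (by have := t.isLt; omega)]

/-- Fibrewise count along `U ↦ (U 0, tail U)`: if `good (cons s U') ↔ c s ∧ good' s U'` then
`#{U : good U} = ∑_s [c s] · #{U' : good' s U'}`. -/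
theorem scc_card_decomp [Fintype S] (T : ℕ) (good : (Fin (T + 1) → S) → Prop)
    [DecidablePred good] (c : S → Prop) [DecidablePred c] (good' : S → (Fin T → S) → Prop)
    [∀ s, DecidablePred (good' s)] (h : ∀ s U', good (Fin.cons s U') ↔ (c s ∧ good' s U')) :
    (((univ : Finset (Fin (T + 1) → S)).filter good).card : ℝ) =
      ∑ s, if c s then (((univ : Finset (Fin T → S)).filter (good' s)).card : ℝ) else 0 := by
  have hcount : ((univ : Finset (Fin (T + 1) → S)).filter good).card =
      ((univ : Finset (S × (Fin T → S))).filter fun p => c p.1 ∧ good' p.1 p.2).card := by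
    refine (Finset.card_equiv (Fin.consEquiv fun _ : Fin (T + 1) => S) fun p => ?_).symm
    simp only [mem_filter, mem_univ, true_and]
    exact (h p.1 p.2).symm
  rw [hcount, Finset.card_filter, Fintype.sum_prod_type, Nat.cast_sum]
  refine Finset.sum_congr rfl fun s _ => ?_
  by_cases hc : c s
  · simp only [hc, true_and, if_true, Finset.card_filter, Nat.cast_sum]
  · simp [hc]

/-! ### One direction `j`: fibre sizes, the involution, the pointwise Jensen, the step inequality -/

/-- The number of good points on the `j`-fibre is constant on the fibre. -/
theorem scc_d_update [Fintype S] (j : J) (InG : (J → S) → Prop) (d : (J → S) → ℕ)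
    (hd : ∀ v, d v = ((univ : Finset S).filter fun s => InG (Function.update v j s)).card)
    (v : J → S) (s : S) : d (Function.update v j s) = d v := by
  simp only [hd, Function.update_idem]

/-- The pointwise Jensen at a good point `v` (direction `j`, `R` = stable good symbols, `v j ∈ R`):
`log d + ((u+1)/d) log q'(v) − ((u+1)/d) log(u+1) + (1/d) Σ_{s ∈ R, s ≠ v j} log q'(v[j↦s])
≤ log N + log q(v)`, from `N q(v) = Σ_{s ∈ R} q'(v[j↦s])` and the concavity of `log` with the
weights `1/d` on `R ∖ {v j}` and `(u+1)/d` on `v j` (which sum to `1` because `#R + u = d`). -/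
theorem scc_pointwise [Fintype S] [DecidableEq S] (j : J) (InG : (J → S) → Prop)
    (St : (J → S) → (J → S) → Prop) (hrefl : ∀ v, St v v)
    (d u : (J → S) → ℕ)
    (hd : ∀ v, d v = ((univ : Finset S).filter fun s => InG (Function.update v j s)).card)
    (hu : ∀ v, u v = ((univ : Finset S).filter fun s =>
      InG (Function.update v j s) ∧ ¬ St v (Function.update v j s)).card)
    (q q' : (J → S) → ℝ) (hq' : ∀ w, InG w → 0 < q' w) (v : J → S) (hv : InG v)
    (hq : q v = (Fintype.card S : ℝ)⁻¹ *
      ∑ s, if InG (Function.update v j s) ∧ St v (Function.update v j s)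
        then q' (Function.update v j s) else 0) :
    0 < q v ∧
    Real.log (d v) + ((u v : ℝ) + 1) / d v * Real.log (q' v) -
        ((u v : ℝ) + 1) / d v * Real.log ((u v : ℝ) + 1) +
        (d v : ℝ)⁻¹ * ∑ s ∈ ((univ : Finset S).filter fun s =>
          InG (Function.update v j s) ∧ St v (Function.update v j s)).erase (v j),
            Real.log (q' (Function.update v j s))
      ≤ Real.log (Fintype.card S) + Real.log (q v) := by
  -- the stable good symbols `R`, with `v j ∈ R`, `#R + u = d`
  set R : Finset S := (univ : Finset S).filter fun s =>
    InG (Function.update v j s) ∧ St v (Function.update v j s) with hR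
  have hvj : v j ∈ R := by
    simp only [hR, mem_filter, mem_univ, true_and, Function.update_eq_self]
    exact ⟨hv, hrefl v⟩
  have hRu : (R.card : ℝ) + u v = d v := by
    have h := Finset.card_filter_add_card_filter_not
      (s := (univ : Finset S).filter fun s => InG (Function.update v j s))
      (fun s => St v (Function.update v j s))
    rw [Finset.filter_filter, Finset.filter_filter] at h
    rw [hd, hu, hR]
    exact_mod_cast h
  have hR1 : (1 : ℝ) ≤ R.card := by exact_mod_cast Finset.card_pos.2 ⟨v j, hvj⟩
  have hu0 : (0 : ℝ) ≤ u v := Nat.cast_nonneg _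
  have hd0 : (0 : ℝ) < d v := by linarith
  have hu1 : (0 : ℝ) < (u v : ℝ) + 1 := by linarith
  have hN0 : (0 : ℝ) < Fintype.card S := by
    have : 0 < Fintype.card S := Fintype.card_pos_iff.2 ⟨v j⟩
    exact_mod_cast this
  -- `N q v = Σ_{s ∈ R} q'(v[j↦s]) > 0`
  have hsumR : (∑ s, if InG (Function.update v j s) ∧ St v (Function.update v j s)
      then q' (Function.update v j s) else 0) = ∑ s ∈ R, q' (Function.update v j s) := by
    rw [hR, Finset.sum_filter]
  have hRpos : ∀ s ∈ R, 0 < q' (Function.update v j s) := fun s hs => by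
    simp only [hR, mem_filter, mem_univ, true_and] at hs
    exact hq' _ hs.1
  have hNq : (Fintype.card S : ℝ) * q v = ∑ s ∈ R, q' (Function.update v j s) := by
    rw [hq, hsumR, ← mul_assoc, mul_inv_cancel₀ hN0.ne', one_mul]
  have hSpos : 0 < ∑ s ∈ R, q' (Function.update v j s) :=
    Finset.sum_pos hRpos ⟨v j, hvj⟩
  have hqpos : 0 < q v := by
    have h : 0 < (Fintype.card S : ℝ) * q v := by rw [hNq]; exact hSpos
    exact pos_of_mul_pos_right h hN0.le
  refine ⟨hqpos, ?_⟩
  -- weights and points of the Jensen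
  set w : S → ℝ := fun s => if s = v j then ((u v : ℝ) + 1) / d v else (d v : ℝ)⁻¹ with hw
  set x : S → ℝ := fun s => if s = v j then (d v : ℝ) * q' v / ((u v : ℝ) + 1)
    else (d v : ℝ) * q' (Function.update v j s) with hx
  have hw0 : ∀ s ∈ R, 0 ≤ w s := fun s _ => by
    simp only [hw]; split_ifs <;> positivity
  have hcardE : ((R.erase (v j)).card : ℝ) = R.card - 1 := by
    rw [Finset.card_erase_of_mem hvj, Nat.cast_sub (Finset.card_pos.2 ⟨v j, hvj⟩), Nat.cast_one]
  have hw1 : ∑ s ∈ R, w s = 1 := by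
    rw [← Finset.add_sum_erase R w hvj]
    have h2 : ∑ s ∈ R.erase (v j), w s = ∑ s ∈ R.erase (v j), (d v : ℝ)⁻¹ :=
      Finset.sum_congr rfl fun s hs => by simp only [hw, Finset.ne_of_mem_erase hs, if_false]
    rw [h2, Finset.sum_const, nsmul_eq_mul, hcardE]
    simp only [hw, if_true]
    field_simp
    linarith
  have hxpos : ∀ s ∈ R, x s ∈ Set.Ioi (0 : ℝ) := fun s hs => by
    simp only [hx, Set.mem_Ioi]
    split_ifs
    · exact div_pos (mul_pos hd0 (hq' v hv)) hu1
    · exact mul_pos hd0 (hRpos s hs)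
  -- Jensen
  have hJ := (strictConcaveOn_log_Ioi.concaveOn).le_map_sum hw0 hw1 hxpos
  -- the weighted mean of the points is `N q v`
  have hmean : ∑ s ∈ R, w s • x s = (Fintype.card S : ℝ) * q v := by
    rw [hNq, ← Finset.add_sum_erase R _ hvj, ← Finset.add_sum_erase R _ hvj]
    congr 1
    · simp only [hw, hx, if_true, smul_eq_mul, Function.update_eq_self]
      field_simp
    · refine Finset.sum_congr rfl fun s hs => ?_
      simp only [hw, hx, Finset.ne_of_mem_erase hs, if_false, smul_eq_mul]
      field_simp
  -- the weighted mean of the logs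
  have hlogs : ∑ s ∈ R, w s • Real.log (x s) =
      Real.log (d v) + ((u v : ℝ) + 1) / d v * Real.log (q' v) -
        ((u v : ℝ) + 1) / d v * Real.log ((u v : ℝ) + 1) +
        (d v : ℝ)⁻¹ * ∑ s ∈ R.erase (v j), Real.log (q' (Function.update v j s)) := by
    rw [← Finset.add_sum_erase R _ hvj]
    have hfirst : w (v j) • Real.log (x (v j)) =
        ((u v : ℝ) + 1) / d v * (Real.log (d v) + Real.log (q' v) - Real.log ((u v : ℝ) + 1)) := by
      simp only [hw, hx, if_true, smul_eq_mul]
      rw [Real.log_div (mul_pos hd0 (hq' v hv)).ne' hu1.ne', Real.log_mul hd0.ne' (hq' v hv).ne']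
    have hrest : ∑ s ∈ R.erase (v j), w s • Real.log (x s) =
        ∑ s ∈ R.erase (v j), ((d v : ℝ)⁻¹ * Real.log (d v) +
          (d v : ℝ)⁻¹ * Real.log (q' (Function.update v j s))) := by
      refine Finset.sum_congr rfl fun s hs => ?_
      simp only [hw, hx, Finset.ne_of_mem_erase hs, if_false, smul_eq_mul]
      rw [Real.log_mul hd0.ne' (hRpos s (Finset.mem_of_mem_erase hs)).ne', mul_add]
    rw [hfirst, hrest, Finset.sum_add_distrib, Finset.sum_const, nsmul_eq_mul, hcardE,
      ← Finset.mul_sum]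
    have hdinv : (d v : ℝ)⁻¹ * (d v : ℝ) = 1 := inv_mul_cancel₀ hd0.ne'
    have hsplit : ((u v : ℝ) + 1) / d v + ((R.card : ℝ) - 1) * (d v : ℝ)⁻¹ = 1 := by
      field_simp
      linarith
    have key : ((u v : ℝ) + 1) / d v * Real.log (d v) + ((R.card : ℝ) - 1) * ((d v : ℝ)⁻¹ *
        Real.log (d v)) = Real.log (d v) := by
      calc ((u v : ℝ) + 1) / d v * Real.log (d v) + ((R.card : ℝ) - 1) * ((d v : ℝ)⁻¹ *
          Real.log (d v)) = (((u v : ℝ) + 1) / d v + ((R.card : ℝ) - 1) * (d v : ℝ)⁻¹) *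
            Real.log (d v) := by ring
        _ = Real.log (d v) := by rw [hsplit, one_mul]
    linarith [key]
  rw [hmean, Real.log_mul hN0.ne' hqpos.ne'] at hJ
  rw [← hlogs]
  exact hJ


/-- The involution `(v, s) ↦ (v[j↦s], v j)` of `(J → S) × S`. -/
theorem scc_invol (j : J) :
    Function.Involutive (fun p : (J → S) × S => (Function.update p.1 j p.2, p.1 j)) := fun p => by
  simp only [Function.update_idem, Function.update_self, Function.update_eq_self, Prod.mk.eta]

/-- Re-summation of the cross terms through the involution: over good `v`, with `R_v` the stable
good symbols, `Σ_v d(v)⁻¹ Σ_{s ∈ R_v ∖ {v j}} f(v[j↦s]) = Σ_v (#R_v − 1)·d(v)⁻¹·f(v)` — because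
`d` is constant on fibres and `St` is symmetric. -/
theorem scc_exchange [Fintype S] [Fintype J] [DecidableEq S] (j : J) (InG : (J → S) → Prop)
    (St : (J → S) → (J → S) → Prop) (hsymm : ∀ v w, St v w → St w v)
    (d : (J → S) → ℕ)
    (hd : ∀ v, d v = ((univ : Finset S).filter fun s => InG (Function.update v j s)).card)
    (f : (J → S) → ℝ) :
    ∑ v ∈ univ.filter InG, (d v : ℝ)⁻¹ * ∑ s ∈ ((univ : Finset S).filter fun s =>
        InG (Function.update v j s) ∧ St v (Function.update v j s)).erase (v j),
          f (Function.update v j s) =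
      ∑ v ∈ univ.filter InG, ((((univ : Finset S).filter fun s =>
        InG (Function.update v j s) ∧ St v (Function.update v j s)).erase (v j)).card : ℝ) *
          (d v : ℝ)⁻¹ * f v := by
  -- the ordered pairs `P'` and the double-sum identity
  set P' : Finset ((J → S) × S) := univ.filter fun p => InG p.1 ∧ (p.2 ≠ p.1 j ∧
    (InG (Function.update p.1 j p.2) ∧ St p.1 (Function.update p.1 j p.2))) with hP'
  have hdouble : ∀ F : (J → S) → S → ℝ,
      ∑ v ∈ univ.filter InG, ∑ s ∈ ((univ : Finset S).filter fun s =>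
        InG (Function.update v j s) ∧ St v (Function.update v j s)).erase (v j), F v s =
      ∑ p ∈ P', F p.1 p.2 := by
    intro F
    rw [hP', Finset.sum_filter, Finset.sum_filter, Fintype.sum_prod_type]
    refine Finset.sum_congr rfl fun v _ => ?_
    dsimp only
    by_cases hv : InG v
    · rw [if_pos hv]
      have hset : ((univ : Finset S).filter fun s =>
          InG (Function.update v j s) ∧ St v (Function.update v j s)).erase (v j) =
          univ.filter fun s => InG v ∧ (s ≠ v j ∧
            (InG (Function.update v j s) ∧ St v (Function.update v j s))) := by
        ext s
        simp only [Finset.mem_erase, Finset.mem_filter, Finset.mem_univ, true_and, hv]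
      rw [hset, Finset.sum_filter]
    · rw [if_neg hv]
      refine (Finset.sum_eq_zero fun s _ => ?_).symm
      rw [if_neg (fun h => hv h.1)]
  -- the involution preserves `P'`
  set ι : (J → S) × S → (J → S) × S := fun p => (Function.update p.1 j p.2, p.1 j) with hι
  have hιι : ∀ p ∈ P', ι (ι p) = p := fun p _ => scc_invol j p
  have hιP : ∀ p ∈ P', ι p ∈ P' := fun p hp => by
    simp only [hP', mem_filter, mem_univ, true_and] at hp ⊢
    obtain ⟨hv, hne, hvs, hst⟩ := hp
    simp only [hι, Function.update_idem, Function.update_self, Function.update_eq_self]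
    exact ⟨hvs, fun h => hne h.symm, hv, hsymm _ _ hst⟩
  -- left side as a pair sum, reflected
  have hL : ∑ v ∈ univ.filter InG, (d v : ℝ)⁻¹ * ∑ s ∈ ((univ : Finset S).filter fun s =>
        InG (Function.update v j s) ∧ St v (Function.update v j s)).erase (v j),
          f (Function.update v j s) = ∑ p ∈ P', (d p.1 : ℝ)⁻¹ * f p.1 := by
    simp_rw [Finset.mul_sum]
    rw [hdouble fun v s => (d v : ℝ)⁻¹ * f (Function.update v j s)]
    refine Finset.sum_nbij' ι ι hιP hιP hιι hιι fun p _ => ?_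
    simp only [hι, scc_d_update j InG d hd]
  -- right side as a pair sum
  have hR : ∑ v ∈ univ.filter InG, ((((univ : Finset S).filter fun s =>
        InG (Function.update v j s) ∧ St v (Function.update v j s)).erase (v j)).card : ℝ) *
          (d v : ℝ)⁻¹ * f v = ∑ p ∈ P', (d p.1 : ℝ)⁻¹ * f p.1 := by
    rw [← hdouble fun v _ => (d v : ℝ)⁻¹ * f v]
    refine Finset.sum_congr rfl fun v _ => ?_
    rw [Finset.sum_const, nsmul_eq_mul, mul_assoc]
  rw [hL, hR]

end ScanCorrelation

end Summit.PneNP.PneNP.Theorems
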